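import Mathlib
import Literature.MathematicalPhysics.QuantumFieldTheory.Balaban1983to89.B9Eq3183
import Literature.MathematicalPhysics.QuantumFieldTheory.Balaban1983to89.B9Eq3112

/-!
# B9 Sect. D, (3.121), (3.125), (3.140) ⇒ (3.141), (3.145) AS MEASURE-LEVEL IDENTITIES — the Faddeev–Popov step on the
affine fibres `{QA = B}` and the two *"vanishing by symmetry"* integrals

Source: T. Balaban, *Propagators for lattice gauge theories in a background field*, Commun. Math. Phys. **99**
(1985) 389–434 [`Balaban1985BackgroundPropagators`], Sect. D pp. 419–420 [PDF 31–32] and pp. 424–425 [PDF 36–37]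
(renders `b2b-balaban-ref1/pages/1985-cmp99-background-propagators/…-p031-x2, -p032-x2, -p036-x2.png`, READ AS IMAGES;
the Euclid text layer is not used).

## The printed texts (verbatim, from the renders)

* p. 419 [PDF 31], (3.121): «HB = Z⁻¹(B)∫dA δ(QA − B)δ_R(RD\*A)e^{−(1/2)⟨A,Δ_πA⟩}A · Z′⁻¹∫dλ δ(Q′λ)e^{−(1/2)‖RD\*A − Δλ‖²}
  = Z⁻¹(B)Z′⁻¹∫dA δ(QA − B) exp[−½⟨A, Δ_πA⟩ − ½‖RD\*A‖²] · ∫dλ δ(Q′λ)δ_R(RD\*A + Δλ)(A + Dλ)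
  = Z⁻¹(B)Z′⁻¹|det(Δ↾_{N(Q′)})|⁻¹∫dA δ(QA − B) · exp[−½⟨A, Δ_πA⟩ − ½⟨A, DRD\*A⟩](A − DG′RD\*A)», and, same page:
  «In fact the expression A − DG′RD\*A has this invariance property. It is obtained by gauge transforming an arbitrary
  configuration A to the subspace {A:RD\*A = 0}.»
* p. 420 [PDF 32]: «Making in the last integral in (3.121) a translation to this minimum we get» (3.123); then (3.124)
  «QGQ\*(QGQ\*)⁻¹ = 1, or RD\*GQ\* = 0, R′ΔD\*GQ\* = 0», and (3.125):
  «RD\*GQ\* = Z⁻¹∫dA e^{−(1/2)⟨A,G⁻¹A⟩}RD\*AQA = Z⁻¹∫dA exp[−½⟨A, Δ_πA⟩ − ½a‖QA‖² − ½‖RD\*A‖²]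
  · RD\*AQA|det(Δ↾_{N(Q′)})|∫dλδ(Q′λ)δ_R(RD\*A + Δλ) = Z⁻¹|det(Δ↾_{N(Q′)})|∫dA exp[−½⟨A, Δ_πA⟩ − ½a‖QA‖²]
  · δ_R(RD\*A)∫dλδ(Q′λ)exp[−½‖RD\*A − Δλ‖²](RD\*A − Δλ)QA = 0   (3.125)
  because RD\*A = 0, and then both integrals above, in A and λ, vanish (by the symmetries A → −A, λ → −λ, and the
  presence of linear terms in A and λ only). Thus the identities (3.124) are proved.»
* p. 424 [PDF 36], (3.140): «𝔓A₀ = Z⁻¹(A₀)∫dA δ(QA)δ_R(RD\*A)e^{−(1/2)⟨A−A₀, G₁⁻¹(A−A₀)⟩}A», then: «We will derive a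
  representation of this operator applying the same transformations as in (3.121). We get
  𝔓A₀ = Z⁻¹(A₀)Z′⁻¹|det(Δ↾_{N(Q′)})|⁻¹e^{−(1/2)⟨A₀, G₁⁻¹A₀⟩} · ∫dA δ(QA)exp[−½⟨A, G₁⁻¹A⟩ + ⟨A, (Δ_π + Δ_π^{(2)})A₀⟩]
  · (A − DG′RD\*A).   (3.141)», and (3.145): «The operator RD\*G̃₁(Δ_π + Δ_π^{(2)}) vanishes by the same argument as in
  (3.125)  RD\*G̃₁(Δ_π + Δ_π^{(2)}) = Z̃⁻¹∫dA δ(QA)e^{−(1/2)⟨A, G₁⁻¹A⟩}RD\*A(Δ_π + Δ_π^{(2)})A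
  = Z̃⁻¹∫dAδ(QA)exp[−½⟨A, (Δ_π + Δ_π^{(2)})A⟩ − ½‖RD\*A‖²] · RD\*A(Δ_π + Δ_π^{(2)})A|det(Δ↾_{N(Q′)})|∫dλ δ(Q′λ)δ_R(RD\*A + Δλ)
  = Z̃⁻¹|det(Δ↾_{N(Q′)})|∫dA δ(QA)δ_R(RD\*A) · exp[−½⟨A, (Δ_π + Δ_π^{(2)})A⟩](Δ_π + Δ_π^{(2)})A∫dλ δ(Q′λ)
  · e^{−(1/2)‖Δλ‖²}(−Δλ) = 0.   (3.145)  Thus the second term in the last line of (3.144) vanishes».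

## The point

The lineage's Sect. D leaves certify (3.118)–(3.126) and (3.139)–(3.152) as MATRIX identities ([g15's] `B9SectDFP`,
`B9Eq3112`; [g17's] `B9Eq3147`, `B9Eq3152`) and name as NOT certified *«the Faddeev–Popov identities (3.118), (3.121),
(3.125) themselves»* (`B9Eq3112`), *«(3.141), (3.144) and (3.145) AS δ-FUNCTION MANIPULATIONS … constants Z′,
|det(Δ↾_{N(Q′)})|, Z̃, Z(A₀)»* (`B9Eq3147`) and *«normalising constants Z(B), Z′, Z̃ and the global Fubini»* (`B9SectDFP`).
[g18's] `B9Eq3183` §1 proved the Faddeev–Popov step AT MEASURE LEVEL for the LINEAR constraint space `{Q̃A = 0}` of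
Sect. E.  Sect. D integrates over the AFFINE fibres `{QA = B}` ((3.121): `δ(QA − B)`) and over translated Gaussians
((3.140): centre `A₀`), and twice concludes `= 0` *"by the symmetries A → −A, λ → −λ"*.  This file supplies exactly these
three missing pieces, as corollaries BY NAME of `B9Eq3183` §1:

1. §1–§2 [folklore]: the affine subspace integral `affInt A₁ P Φ = ∫_{A₁ + Ran P} Φ` (base-point free on the fibre:
   `affInt_base_of_mem`; the fibres `{Q̃A = Q̃A₁}` and `{Q̃A = Q̃A₁, LA = 0}` ARE `A₁ + V`, `A₁ + S`: `fibre_eq_image`,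
   `doubleFibre_eq_image`; whole space: `subInt_univ`), and **the Faddeev–Popov step on affine fibres** `fp_affInt`: for a
   base point `A₁` of the slice (`LA₁ = 0`), EVERY weight `ψ` and EVERY integrand `Φ`,
   `∫_{A₁+V} ψ(LA)Φ(TA) dA = (gramRatio · ∫ψ(LΓw)dw) · ∫_{A₁+S} Φ` — because `L(A₁ + v) = Lv` and `T(A₁ + v) = A₁ + Tv`
   (`T` is the identity on `{LA = 0}`: `T_mulVec_of_landau`); Gaussian weight: `fp_affInt_gaussian(_inv, _normalised)`
   with the constant `κ_FP = B9Eq3183.kappaFP` of (3.183).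
2. §2 [folklore]: **the symmetry argument** — for an ODD weight `ψ(−u) = −ψ(u)` the gauge-orbit integral vanishes
   (`integral_gauge_odd`, Lebesgue measure under `w ↦ −w`), hence `∫_{A₁+V} ψ(LA)Φ(TA) dA = 0` for every `Φ`
   (`fp_affInt_odd`); in particular `∫_{A₁+V} e^{−½‖LA‖²}(LA)_i Φ(TA) dA = 0` (`fp_affInt_firstMoment`) — the print's
   *"∫dλ δ(Q′λ) e^{−(1/2)‖Δλ‖²}(−Δλ) = 0"*.
3. §3, the paper's instance `L = RD*`, `T = 1 − DG′RD*`, `Γ = DN` (hypotheses of §1 discharged by [g18's] `B9Eq3183` §3):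
   * `eq_3121` — **(3.121) at measure level**: for every bond form `K` (the `Δ` of `⟨A, ΔA⟩` in (3.112)), every fibre base
     point `A₁` with `RD*A₁ = 0` (one exists through every configuration: `basePoint_tOp`, the print's *"gauge transforming
     an arbitrary configuration A to the subspace {A:RD\*A = 0}"*), every integrand `Φ`, and ALL bases `P′` of
     `{QA = 0, RD*A = 0}`, `P` of `{QA = 0}`:
     `∫_{QA=B, RD*A=0} e^{−½⟨A,KA⟩}Φ(A) dA = κ_FP⁻¹ ∫_{QA=B} exp[−½⟨A,Δ_πA⟩ − ½‖RD*A‖²] Φ(A − DG′RD*A) dA`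
     (`B = QA₁`); `eq_3121_normalised` — the `Z⁻¹(B)`-normalised means agree literally (constants cancel);
     `eq_3121_3123` — on the fibre the weight IS `e^{½a‖B‖²}e^{−½⟨A,G⁻¹A⟩}` ([g15's] `B9SectDFP.eq_3123_weight`), so the
     normalised (3.121) mean is the normalised `G⁻¹`-Gaussian mean of `Φ∘T` over `{QA = B}` — the integral whose
     *"translation to this minimum"* gives (3.123); `isBasisOf_dconKernel` — a kernel basis `N_S` of [g15's] double
     constraint `[Q_b ; NᵀΔD*]` IS a basis `P′` (link to the integral of `B9Eq3112.eq_3112`).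
   * `eq_3125` — **(3.125)**: `∫ dA e^{−½⟨A,G⁻¹A⟩} (RD*A)_i (QA)_j = 0` over the WHOLE configuration space, for all
     `i, j`, every `K` and every `a_b` (`G⁻¹ = B9SectDFP.Ginv`): split `e^{−½⟨A,G⁻¹A⟩} = e^{−½⟨TA,(K+aQ*Q)TA⟩}e^{−½‖RD*A‖²}`
     EXACTLY (`B9SectDFP.Ginv_quadForm`), `Q(TA) = QA` (`B9SectDFP.Qb_mulVec_tOp`), then item 2 with `V` = everything.
   * `eq_3141` — **(3.140) ⇒ (3.141)**: `∫_{QA=0,RD*A=0} e^{−½⟨A−A₀,G₁⁻¹(A−A₀)⟩}Φ(A) dA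
     = κ_FP⁻¹ e^{−½⟨A₀,G₁⁻¹A₀⟩} ∫_{QA=0} exp[−½⟨A,G₁⁻¹A⟩ + ⟨A,(Δ_π+Δ_π^{(2)})A₀⟩] Φ(A − DG′RD*A) dA` for every `Φ`, `A₀`
     and symmetric `K` (`G₁⁻¹ = B9SectDFP.Ginv K …`, `Δ_π + Δ_π^{(2)} = B9SectDFP.piOp K …`, [g17's] modelling); the
     exponent bookkeeping is `eq_3141_exponent` (`T² = T`: `tOp_mul_tOp`; `TᵀΔ_π = Δ_π`: `transpose_tOp_mul_piOp`).
   * `eq_3145` — **(3.145)**: `∫_{QA=0} e^{−½⟨A,G₁⁻¹A⟩}(RD*A)_i((Δ_π+Δ_π^{(2)})A)_j dA = 0` for all `i, j`.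

## What this file does NOT certify

* The identification of the Gaussian second moment `Z⁻¹∫dA e^{−½⟨A,G⁻¹A⟩} A⊗A` with `G` (first `=` of (3.125)) and of
  the tilted constrained mean with `G̃₁J` ((3.142)–(3.144)): these are [g13's]/[g15's]/[g17's] `B9SectECov.cov_eq_of_genFun`,
  `B9Eq3112.eq_3112`, `B9Eq3147.eq_3143` level statements and are not restated; consequently (3.124)/(3.126) remain
  [g15's] matrix identities `B9Eq3112.eq_3124`, `H_eq_3126` (kernel) — this file adds the integral `= 0` they rest on.
* The middle members of (3.121)/(3.125)/(3.145) (the `λ`-integral BEFORE the `λ`-integration, `δ_R(RD*A + Δλ)(A + Dλ)`):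
  pointwise they are [g16's] `B9Eq3166.eq_3166_point` / [g15's] `B9SectDFP.eq_3121_lambda` (kernel); the global Fubini
  interchange `∫dA∫dλ = ∫dλ∫dA` is replaced here, as in `B9Eq3183`, by the block change of variables `V = S ⊕ Ran Γ`.
* Integrability is never assumed: all identities hold for every `Φ` with Lean's `∫` (Bochner, junk value `0`), because
  they are proved by measure-preserving changes of variables and algebraic identities of the integrands only.
* Nothing analytic (Thm 3.13's bounds, G-B9-10), nothing about the continuum or the renormalisation group.

## Modelling notes, divergence

`V`, `S` are handled through BASIS MATRICES (`B9Eq3170.IsBasisOf`) and `B9Eq3166.subInt` (surface measure induced by the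
dot product of `ℝ^b`); every statement holds for ALL bases (basis independence: `B9Eq3170.subInt_eq_of_isBasisOf`).
DIVERGENCE D-b09.60 (same nature as D-b09.58(b)/59): the print's constant in (3.121)/(3.141) is `Z′⁻¹|det(Δ↾_{N(Q′)})|⁻¹`
(coordinate Lebesgue measures `dA`, `dλ` and `Z′ = ∫dλ δ(Q′λ)e^{−½‖Δλ‖²}`); ours is `κ_FP⁻¹` with
`κ_FP = gramRatio · √(2π)^{dim N(Q′)} / √det(NᵀΔ²N)` (surface measures); `Z′·|det(Δ↾_{N(Q′)})| = √(2π)^{dim N(Q′)}` is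
[g18's] `B9Eq3183.Zprime_mul_absDetOn`, and the two agree up to the Gram factors fixed by the choice of Lebesgue measure on
the subspaces — invisible in every NORMALISED statement (`eq_3121_normalised`, (3.125), (3.145): `= 0`).

RECORDS: GAPS C-B9-82; DIVERGENCE D-b09.60.  Elementary linear algebra + Lebesgue measure (translation / reflection /
reindexing invariance, Gaussian integral); [folklore] + the paper's operators BY NAME; no Literature `def … : Prop` is
introduced or restated.  NOT summit progress; NOT continuum; NOT Clay.  Unit `b2b-balaban-b09` gen 19 (journal CLAIM
B9-SECTD-FP121-MEASURE).
-/

namespace Literature.MathematicalPhysics.QuantumFieldTheory.Balaban1983to89.B9Eq3121Measure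

open Matrix MeasureTheory
open B9Eq3166 (subInt)
open B9Eq3170 (IsBasisOf reducedSet Reduced subInt_eq_of_isBasisOf)
open B9Eq3183 (avgSet gramRatio kappaFP)

noncomputable section

/-! ## §1  Folklore: integrals over affine subspaces `A₁ + Ran P`, fibres, the whole space -/

section Affine

variable {b c₁ r σ ι : Type*}

/-- `∫_{A₁ + Ran P} Φ` — the Lebesgue integral over the AFFINE subspace through `A₁` directed by `Ran P` (surface measure of
the dot product): `√det(PᵀP) · ∫ Φ(A₁ + Pz) dz`.  READING of `∫dA δ(QA − B) … ` ((3.112), (3.121)) with `QA₁ = B`.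
[folklore] -/
def affInt [Fintype b] [Fintype σ] [DecidableEq σ] (A₁ : b → ℝ) (P : Matrix b σ ℝ) (Φ : (b → ℝ) → ℝ) : ℝ :=
  subInt P (fun v => Φ (A₁ + v))

/-- The coordinate form. [folklore] -/
theorem affInt_eq [Fintype b] [Fintype σ] [DecidableEq σ] (A₁ : b → ℝ) (P : Matrix b σ ℝ) (Φ : (b → ℝ) → ℝ) :
    affInt A₁ P Φ = Real.sqrt ((Pᵀ * P).det) * ∫ z : σ → ℝ, Φ (A₁ + P *ᵥ z) := rfl

/-- Through the origin it is the subspace integral. [folklore] -/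
theorem affInt_zero [Fintype b] [Fintype σ] [DecidableEq σ] (P : Matrix b σ ℝ) (Φ : (b → ℝ) → ℝ) :
    affInt 0 P Φ = subInt P Φ := by
  unfold affInt; simp_rw [zero_add]

/-- Constants come out. [folklore] -/
theorem affInt_const_mul [Fintype b] [Fintype σ] [DecidableEq σ] (A₁ : b → ℝ) (P : Matrix b σ ℝ) (c : ℝ)
    (Φ : (b → ℝ) → ℝ) : affInt A₁ P (fun A => c * Φ A) = c * affInt A₁ P Φ :=
  B9Eq3166.subInt_const_mul P c _

/-- BASIS INDEPENDENCE: two bases of the same direction space give the same affine integral. [folklore] -/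
theorem affInt_eq_of_isBasisOf [Fintype b] [Fintype σ] [DecidableEq σ] {P₁ P₂ : Matrix b σ ℝ} {S : Set (b → ℝ)}
    (h₁ : IsBasisOf P₁ S) (h₂ : IsBasisOf P₂ S) (A₁ : b → ℝ) (Φ : (b → ℝ) → ℝ) :
    affInt A₁ P₁ Φ = affInt A₁ P₂ Φ :=
  subInt_eq_of_isBasisOf h₁ h₂ _

/-- The integrand may be changed off the fibre. [folklore] -/
theorem affInt_congr [Fintype b] [Fintype σ] [DecidableEq σ] {P : Matrix b σ ℝ} {S : Set (b → ℝ)} (hP : IsBasisOf P S)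
    {A₁ : b → ℝ} {f g : (b → ℝ) → ℝ} (h : ∀ v ∈ S, f (A₁ + v) = g (A₁ + v)) : affInt A₁ P f = affInt A₁ P g := by
  unfold affInt subInt
  congr 1
  congr 1
  funext z
  exact h _ ((hP.mem_iff _).mpr ⟨z, rfl⟩)

/-- The subspace integrand may be changed off the subspace. [folklore] -/
theorem subInt_congr_mem [Fintype b] [Fintype σ] [DecidableEq σ] {P : Matrix b σ ℝ} {S : Set (b → ℝ)}
    (hP : IsBasisOf P S) {f g : (b → ℝ) → ℝ} (h : ∀ A ∈ S, f A = g A) : subInt P f = subInt P g := by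
  unfold subInt
  congr 1
  congr 1
  funext z
  exact h _ ((hP.mem_iff _).mpr ⟨z, rfl⟩)

/-- BASE-POINT INDEPENDENCE (translation invariance of Lebesgue measure on the fibre coordinates):
`∫_{(A₁ + Pz₀) + Ran P} Φ = ∫_{A₁ + Ran P} Φ`. [folklore] -/
theorem affInt_base [Fintype b] [Fintype σ] [DecidableEq σ] (A₁ : b → ℝ) (P : Matrix b σ ℝ) (z₀ : σ → ℝ)
    (Φ : (b → ℝ) → ℝ) : affInt (A₁ + P *ᵥ z₀) P Φ = affInt A₁ P Φ := by
  unfold affInt subInt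
  congr 1
  show ∫ z : σ → ℝ, Φ (A₁ + P *ᵥ z₀ + P *ᵥ z) = ∫ z : σ → ℝ, Φ (A₁ + P *ᵥ z)
  have h := integral_add_right_eq_self (μ := (volume : Measure (σ → ℝ))) (fun z : σ → ℝ => Φ (A₁ + P *ᵥ z)) z₀
  have h' : ∀ z : σ → ℝ, A₁ + P *ᵥ z₀ + P *ᵥ z = A₁ + P *ᵥ (z + z₀) := fun z => by
    rw [mulVec_add]; abel
  simp_rw [h']
  exact h

/-- Any two points of the same fibre give the same affine integral. [folklore] -/
theorem affInt_base_of_mem [Fintype b] [Fintype σ] [DecidableEq σ] {P : Matrix b σ ℝ} {S : Set (b → ℝ)}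
    (hP : IsBasisOf P S) {A₁ A₁' : b → ℝ} (h : A₁' - A₁ ∈ S) (Φ : (b → ℝ) → ℝ) :
    affInt A₁' P Φ = affInt A₁ P Φ := by
  obtain ⟨z₀, hz₀⟩ := (hP.mem_iff _).mp h
  have hA : A₁' = A₁ + P *ᵥ z₀ := by rw [hz₀]; abel
  rw [hA, affInt_base]

/-- The fibre `{A | Q̃A = Q̃A₁}` of the averaging map IS the affine subspace `A₁ + {Q̃A = 0}` — the support of `δ(QA − B)`,
`B = QA₁`. [folklore] -/
theorem fibre_eq_image [Fintype b] (Qt : Matrix c₁ b ℝ) (A₁ : b → ℝ) :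
    {A : b → ℝ | Qt *ᵥ A = Qt *ᵥ A₁} = (fun v => A₁ + v) '' avgSet Qt := by
  ext A
  simp only [Set.mem_setOf_eq, Set.mem_image, avgSet]
  constructor
  · intro h
    exact ⟨A - A₁, by rw [mulVec_sub, h, sub_self], by abel⟩
  · rintro ⟨v, hv, rfl⟩
    rw [mulVec_add, hv, add_zero]

/-- The double fibre `{A | Q̃A = Q̃A₁, LA = 0}` through a point `A₁` of the slice (`LA₁ = 0`) IS `A₁ + {Q̃A = 0, LA = 0}` —
the support of `δ(QA − B)δ_R(RD*A)`. [folklore] -/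
theorem doubleFibre_eq_image [Fintype b] [DecidableEq b] (Qt : Matrix c₁ b ℝ) (L : Matrix r b ℝ) {A₁ : b → ℝ}
    (hA₁ : L *ᵥ A₁ = 0) :
    {A : b → ℝ | Qt *ᵥ A = Qt *ᵥ A₁ ∧ L *ᵥ A = 0} = (fun v => A₁ + v) '' reducedSet Qt L := by
  ext A
  simp only [Set.mem_setOf_eq, Set.mem_image, reducedSet]
  constructor
  · rintro ⟨h1, h2⟩
    exact ⟨A - A₁, ⟨by rw [mulVec_sub, h1, sub_self], by rw [mulVec_sub, h2, hA₁, sub_zero]⟩, by abel⟩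
  · rintro ⟨v, hv, rfl⟩
    exact ⟨by rw [mulVec_add, hv.avg, add_zero], by rw [mulVec_add, hA₁, hv.landau, add_zero]⟩

/-- No averaging constraint: `{0·A = 0}` is everything. [folklore] -/
theorem avgSet_zero [Fintype b] : avgSet (0 : Matrix c₁ b ℝ) = Set.univ :=
  Set.eq_univ_of_forall fun A => show (0 : Matrix c₁ b ℝ) *ᵥ A = 0 from zero_mulVec A

/-- No averaging constraint: the slice is `{LA = 0}`. [folklore] -/
theorem reducedSet_zero [Fintype b] [DecidableEq b] (L : Matrix r b ℝ) :
    reducedSet (0 : Matrix c₁ b ℝ) L = {A | L *ᵥ A = 0} :=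
  Set.ext fun A => ⟨fun h => (h : Reduced (0 : Matrix c₁ b ℝ) L A).landau,
    fun h => show Reduced (0 : Matrix c₁ b ℝ) L A from ⟨zero_mulVec A, h⟩⟩

/-- Reindexing the coordinates of `ℝ^ι` along `e : σ ≃ ι` preserves Lebesgue measure. [folklore] -/
theorem integral_comp_equiv [Fintype σ] [Fintype ι] (e : σ ≃ ι) (g : (ι → ℝ) → ℝ) :
    ∫ z : σ → ℝ, g (z ∘ ⇑e.symm) = ∫ w : ι → ℝ, g w := by
  have hmp := MeasureTheory.volume_measurePreserving_piCongrLeft (fun _ : ι => ℝ) e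
  have happ : ∀ z : σ → ℝ, (MeasurableEquiv.piCongrLeft (fun _ : ι => ℝ) e) z = z ∘ ⇑e.symm := by
    intro z; funext i
    simp only [MeasurableEquiv.coe_piCongrLeft, Equiv.piCongrLeft_apply_eq_cast, cast_eq, Function.comp_apply]
  calc ∫ z : σ → ℝ, g (z ∘ ⇑e.symm)
      = ∫ z : σ → ℝ, g ((MeasurableEquiv.piCongrLeft (fun _ : ι => ℝ) e) z) := by simp_rw [happ]
    _ = ∫ w : ι → ℝ, g w := hmp.integral_comp' g

/-- Reindexing the columns of a basis matrix does not change the subspace integral. [folklore] -/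
theorem subInt_reindex [Fintype b] [Fintype σ] [Fintype ι] [DecidableEq σ] [DecidableEq ι] (P : Matrix b ι ℝ)
    (e : σ ≃ ι) (f : (b → ℝ) → ℝ) : subInt (P.submatrix id ⇑e) f = subInt P f := by
  unfold subInt
  have hgram : (P.submatrix id ⇑e)ᵀ * P.submatrix id ⇑e = (Pᵀ * P).submatrix ⇑e ⇑e := by
    rw [transpose_submatrix, submatrix_mul Pᵀ P (⇑e) id (⇑e) Function.bijective_id]
  have hmv : ∀ z : σ → ℝ, P.submatrix id ⇑e *ᵥ z = P *ᵥ (z ∘ ⇑e.symm) := fun z => by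
    rw [submatrix_mulVec_equiv]; rfl
  rw [hgram, det_submatrix_equiv_self]
  simp_rw [hmv]
  congr 1
  exact integral_comp_equiv e (fun w => f (P *ᵥ w))

/-- The identity matrix is a basis of the whole space. [folklore] -/
theorem isBasisOf_one [Fintype b] [DecidableEq b] : IsBasisOf (1 : Matrix b b ℝ) (Set.univ : Set (b → ℝ)) :=
  ⟨fun v w h => by simpa only [one_mulVec] using h, Set.eq_univ_of_forall fun A => ⟨A, one_mulVec A⟩⟩

/-- **The whole space**: for ANY basis `P` of `ℝ^b` (any index type), `subInt P f = ∫ f` — the surface measure of the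
top-dimensional subspace is Lebesgue measure. [folklore] -/
theorem subInt_univ [Fintype b] [Fintype ι] [DecidableEq b] [DecidableEq ι] {P : Matrix b ι ℝ}
    (hP : IsBasisOf P Set.univ) (f : (b → ℝ) → ℝ) : subInt P f = ∫ A : b → ℝ, f A := by
  have hsurj : Function.Surjective P.mulVec := Set.range_eq_univ.mp hP.range_eq
  have hbij : Function.Bijective (P.mulVecLin : (ι → ℝ) → (b → ℝ)) := by
    rw [Matrix.coe_mulVecLin]; exact ⟨hP.inj, hsurj⟩
  have hcard : Fintype.card b = Fintype.card ι := by
    have h := (LinearEquiv.ofBijective P.mulVecLin hbij).finrank_eq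
    rw [Module.finrank_fintype_fun_eq_card, Module.finrank_fintype_fun_eq_card] at h
    exact h.symm
  obtain ⟨e⟩ : Nonempty (b ≃ ι) := ⟨Fintype.equivOfCardEq hcard⟩
  have hQ : IsBasisOf (P.submatrix id ⇑e) Set.univ := by
    refine ⟨?_, Set.eq_univ_of_forall fun X => ?_⟩
    · intro v w h
      have h2 : P *ᵥ (v ∘ ⇑e.symm) = P *ᵥ (w ∘ ⇑e.symm) := by
        simpa only [submatrix_mulVec_equiv, Function.comp_id] using h
      have h3 := hP.inj h2
      funext i
      have h4 := congrFun h3 (e i)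
      simpa only [Function.comp_apply, Equiv.symm_apply_apply] using h4
    · obtain ⟨z, hz⟩ := hsurj X
      refine ⟨z ∘ ⇑e, ?_⟩
      have hzz : (z ∘ ⇑e) ∘ ⇑e.symm = z := by funext i; simp
      rw [submatrix_mulVec_equiv, hzz, hz]
      rfl
  rw [← subInt_reindex P e f, subInt_eq_of_isBasisOf hQ isBasisOf_one f, B9Eq3166.subInt_one]

/-- The whole space, affine form: `∫_{A₁ + ℝ^b} Φ = ∫ Φ`. [folklore] -/
theorem affInt_univ [Fintype b] [Fintype ι] [DecidableEq b] [DecidableEq ι] {P : Matrix b ι ℝ}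
    (hP : IsBasisOf P Set.univ) (A₁ : b → ℝ) (Φ : (b → ℝ) → ℝ) : affInt A₁ P Φ = ∫ A : b → ℝ, Φ A := by
  unfold affInt
  rw [subInt_univ hP]
  exact integral_add_left_eq_self (μ := (volume : Measure (b → ℝ))) Φ A₁

/-- Lebesgue measure on `ℝ^τ` is symmetric under `z ↦ −z` ([pv16's] `Beta.GaussianIntegral.integral_comp_mulVec` with the
matrix `−1`, as in [g16's] `B9Eq3166.subInt_comp_neg`). [folklore] -/
theorem integral_comp_neg_pi {τ : Type*} [Fintype τ] [DecidableEq τ] (f : (τ → ℝ) → ℝ) :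
    ∫ z : τ → ℝ, f (-z) = ∫ z : τ → ℝ, f z := by
  have hdet : (-1 : Matrix τ τ ℝ).det ≠ 0 := by
    rw [det_neg, det_one, mul_one]; exact pow_ne_zero _ (by norm_num)
  calc ∫ z : τ → ℝ, f (-z) = ∫ z : τ → ℝ, f ((-1 : Matrix τ τ ℝ) *ᵥ z) := by simp_rw [neg_mulVec, one_mulVec]
    _ = |(-1 : Matrix τ τ ℝ).det|⁻¹ * ∫ z : τ → ℝ, f z :=
        Beta.GaussianIntegral.integral_comp_mulVec _ hdet f
    _ = ∫ z : τ → ℝ, f z := by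
        rw [det_neg, det_one, mul_one, abs_pow, abs_neg, abs_one, one_pow, inv_one, one_mul]

/-- `⟨Tv, y⟩ = ⟨v, Tᵀy⟩`. [folklore] -/
theorem dotProduct_mulVec_left {m n : Type*} [Fintype m] [Fintype n] (T : Matrix m n ℝ) (v : n → ℝ) (y : m → ℝ) :
    (T *ᵥ v) ⬝ᵥ y = v ⬝ᵥ (Tᵀ *ᵥ y) := by
  rw [mulVec_transpose, dotProduct_comm v, ← dotProduct_mulVec, dotProduct_comm]

end Affine

/-! ## §2  Folklore: the Faddeev–Popov step on affine fibres, and the symmetry `A → −A, λ → −λ` -/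

section AffineFP

variable {b c₁ r τ σ : Type*}

variable {Qt : Matrix c₁ b ℝ} {L : Matrix r b ℝ} {T : Matrix b b ℝ} {Γ : Matrix b τ ℝ} {M : Matrix τ b ℝ}

/-- `T` is the identity on `{LA = 0}` (no averaging constraint needed): [g18's] `B9Eq3183.T_mulVec_of_mem` with `Q̃ = 0`.
[cite: Balaban1985BackgroundPropagators, p.419 (text after (3.119))] -/
theorem T_mulVec_of_landau [Fintype b] [Fintype τ] [DecidableEq b] (hLT : L * T = 0) (hcompl : 1 - T = Γ * M)
    (hLΓ : Function.Injective (L * Γ).mulVec) {A : b → ℝ} (hA : L *ᵥ A = 0) : T *ᵥ A = A :=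
  B9Eq3183.T_mulVec_of_mem (Qt := (0 : Matrix r b ℝ)) hLT hcompl hLΓ
    (show Reduced (0 : Matrix r b ℝ) L A from ⟨zero_mulVec A, hA⟩)

/-- On the fibre through a slice point `A₁` the Faddeev–Popov integrand factorises through the linear one:
`ψ(L(A₁ + v))Φ(T(A₁ + v)) = ψ(Lv)Φ(A₁ + Tv)`. [cite: Balaban1985BackgroundPropagators, (3.121) p.419] -/
theorem fp_integrand_affine [Fintype b] [Fintype τ] [DecidableEq b] (hLT : L * T = 0) (hcompl : 1 - T = Γ * M)
    (hLΓ : Function.Injective (L * Γ).mulVec) {A₁ : b → ℝ} (hA₁ : L *ᵥ A₁ = 0) (ψ : (r → ℝ) → ℝ)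
    (Φ : (b → ℝ) → ℝ) (v : b → ℝ) :
    ψ (L *ᵥ (A₁ + v)) * Φ (T *ᵥ (A₁ + v)) = ψ (L *ᵥ v) * Φ (A₁ + T *ᵥ v) := by
  rw [mulVec_add, hA₁, zero_add, mulVec_add, T_mulVec_of_landau hLT hcompl hLΓ hA₁]

/-- **THE FADDEEV–POPOV STEP ON THE AFFINE FIBRES, for every weight and every integrand**: for a slice point `A₁`
(`LA₁ = 0`), ANY basis `P` of `V = {Q̃A = 0}` and ANY basis `P′` of `S = {Q̃A = 0, LA = 0}`,
`∫_{A₁+V} ψ(LA)Φ(TA) dA = (gramRatio(P′) · ∫ψ(LΓw)dw) · ∫_{A₁+S} Φ` — [g18's] `B9Eq3183.fp_subInt` applied to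
`Φ(A₁ + ·)`. [cite: Balaban1985BackgroundPropagators, (3.121) p.419] -/
theorem fp_affInt [Fintype b] [Fintype τ] [Fintype σ] [DecidableEq b] [DecidableEq τ] [DecidableEq σ]
    (hLT : L * T = 0) (hTΓ : T * Γ = 0) (hcompl : 1 - T = Γ * M) (hQΓ : Qt * Γ = 0)
    (hLΓ : Function.Injective (L * Γ).mulVec) {P : Matrix b (σ ⊕ τ) ℝ} (hP : IsBasisOf P (avgSet Qt))
    {P' : Matrix b σ ℝ} (hP' : IsBasisOf P' (reducedSet Qt L)) {A₁ : b → ℝ} (hA₁ : L *ᵥ A₁ = 0)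
    (ψ : (r → ℝ) → ℝ) (Φ : (b → ℝ) → ℝ) :
    affInt A₁ P (fun A => ψ (L *ᵥ A) * Φ (T *ᵥ A)) =
      (gramRatio P' Γ * ∫ w : τ → ℝ, ψ ((L * Γ) *ᵥ w)) * affInt A₁ P' Φ := by
  unfold affInt
  simp_rw [fp_integrand_affine hLT hcompl hLΓ hA₁ ψ Φ]
  exact B9Eq3183.fp_subInt hLT hTΓ hcompl hQΓ hLΓ hP hP' ψ (fun X => Φ (A₁ + X))

/-- **THE SYMMETRY ARGUMENT** *"by the symmetries A → −A, λ → −λ, and the presence of linear terms … only"*: for an ODD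
weight the gauge-orbit integral vanishes (`LΓ(−w) = −LΓw`, Lebesgue measure under `w ↦ −w`).
[cite: Balaban1985BackgroundPropagators, (3.125) p.420] -/
theorem integral_gauge_odd [Fintype b] [Fintype τ] [DecidableEq τ] (ψ : (r → ℝ) → ℝ) (hψ : ∀ u, ψ (-u) = -ψ u) :
    ∫ w : τ → ℝ, ψ ((L * Γ) *ᵥ w) = 0 := by
  have h := integral_comp_neg_pi (fun w : τ → ℝ => ψ ((L * Γ) *ᵥ w))
  simp only [mulVec_neg, hψ, integral_neg] at h
  linarith

/-- **Odd weights integrate to zero over every fibre, against every integrand of `TA`** — the measure content of the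
last `=` of (3.125) and of (3.145). [cite: Balaban1985BackgroundPropagators, (3.125) p.420; (3.145) p.424] -/
theorem fp_affInt_odd [Fintype b] [Fintype τ] [Fintype σ] [DecidableEq b] [DecidableEq τ] [DecidableEq σ]
    (hLT : L * T = 0) (hTΓ : T * Γ = 0) (hcompl : 1 - T = Γ * M) (hQΓ : Qt * Γ = 0)
    (hLΓ : Function.Injective (L * Γ).mulVec) {P : Matrix b (σ ⊕ τ) ℝ} (hP : IsBasisOf P (avgSet Qt))
    {P' : Matrix b σ ℝ} (hP' : IsBasisOf P' (reducedSet Qt L)) {A₁ : b → ℝ} (hA₁ : L *ᵥ A₁ = 0)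
    (ψ : (r → ℝ) → ℝ) (hψ : ∀ u, ψ (-u) = -ψ u) (Φ : (b → ℝ) → ℝ) :
    affInt A₁ P (fun A => ψ (L *ᵥ A) * Φ (T *ᵥ A)) = 0 := by
  rw [fp_affInt hLT hTΓ hcompl hQΓ hLΓ hP hP' hA₁ ψ Φ, integral_gauge_odd ψ hψ, mul_zero, zero_mul]

/-- **The printed instance**: `∫_{A₁+V} e^{−½‖LA‖²}(LA)_i Φ(TA) dA = 0` — *"∫dλ δ(Q′λ) e^{−(1/2)‖Δλ‖²}(−Δλ) = 0"*.
[cite: Balaban1985BackgroundPropagators, (3.125) p.420; (3.145) p.424] -/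
theorem fp_affInt_firstMoment [Fintype b] [Fintype r] [Fintype τ] [Fintype σ] [DecidableEq b] [DecidableEq τ]
    [DecidableEq σ] (hLT : L * T = 0) (hTΓ : T * Γ = 0) (hcompl : 1 - T = Γ * M) (hQΓ : Qt * Γ = 0)
    (hLΓ : Function.Injective (L * Γ).mulVec) {P : Matrix b (σ ⊕ τ) ℝ} (hP : IsBasisOf P (avgSet Qt))
    {P' : Matrix b σ ℝ} (hP' : IsBasisOf P' (reducedSet Qt L)) {A₁ : b → ℝ} (hA₁ : L *ᵥ A₁ = 0) (i : r)
    (Φ : (b → ℝ) → ℝ) :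
    affInt A₁ P (fun A => Real.exp (-(1/2 : ℝ) * ((L *ᵥ A) ⬝ᵥ (L *ᵥ A))) * (L *ᵥ A) i * Φ (T *ᵥ A)) = 0 := by
  have h := fp_affInt_odd hLT hTΓ hcompl hQΓ hLΓ hP hP' hA₁ (fun u => Real.exp (-(1/2 : ℝ) * (u ⬝ᵥ u)) * u i)
    (fun u => by simp only [neg_dotProduct, dotProduct_neg, neg_neg, Pi.neg_apply, mul_neg]) Φ
  beta_reduce at h
  exact h

/-- **THE STEP WITH THE PRINTED WEIGHT `exp(−½‖RD\*A‖²)` on the affine fibres**: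
`∫_{A₁+V} e^{−½‖LA‖²}Φ(TA) dA = κ_FP · ∫_{A₁+S} Φ` for every `Φ` and all bases.
[cite: Balaban1985BackgroundPropagators, (3.121) p.419] -/
theorem fp_affInt_gaussian [Fintype b] [Fintype r] [Fintype τ] [Fintype σ] [DecidableEq b] [DecidableEq τ]
    [DecidableEq σ] (hLT : L * T = 0) (hTΓ : T * Γ = 0) (hcompl : 1 - T = Γ * M) (hQΓ : Qt * Γ = 0)
    (hLΓ : Function.Injective (L * Γ).mulVec) {P : Matrix b (σ ⊕ τ) ℝ} (hP : IsBasisOf P (avgSet Qt))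
    {P' : Matrix b σ ℝ} (hP' : IsBasisOf P' (reducedSet Qt L)) {A₁ : b → ℝ} (hA₁ : L *ᵥ A₁ = 0)
    (Φ : (b → ℝ) → ℝ) :
    affInt A₁ P (fun A => Real.exp (-(1/2 : ℝ) * ((L *ᵥ A) ⬝ᵥ (L *ᵥ A))) * Φ (T *ᵥ A)) =
      kappaFP L Γ P' * affInt A₁ P' Φ := by
  have h := fp_affInt hLT hTΓ hcompl hQΓ hLΓ hP hP' hA₁ (fun u => Real.exp (-(1/2 : ℝ) * (u ⬝ᵥ u))) Φ
  beta_reduce at h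
  rw [h, B9Eq3183.integral_gauge_gaussian hLΓ]
  rfl

/-- **READ AS PRINTED (left to right)**: `∫_{A₁+S} Φ = κ_FP⁻¹ · ∫_{A₁+V} e^{−½‖LA‖²}Φ(TA) dA` —
`∫dA δ(QA − B)δ_R(RD\*A)Φ(A) = κ_FP⁻¹∫dA δ(QA − B)e^{−½‖RD\*A‖²}Φ(A − DG′RD\*A)`.
[cite: Balaban1985BackgroundPropagators, (3.121) p.419] -/
theorem fp_affInt_gaussian_inv [Fintype b] [Fintype r] [Fintype τ] [Fintype σ] [DecidableEq b] [DecidableEq τ]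
    [DecidableEq σ] (hLT : L * T = 0) (hTΓ : T * Γ = 0) (hcompl : 1 - T = Γ * M) (hQΓ : Qt * Γ = 0)
    (hLΓ : Function.Injective (L * Γ).mulVec) {P : Matrix b (σ ⊕ τ) ℝ} (hP : IsBasisOf P (avgSet Qt))
    {P' : Matrix b σ ℝ} (hP' : IsBasisOf P' (reducedSet Qt L)) {A₁ : b → ℝ} (hA₁ : L *ᵥ A₁ = 0)
    (Φ : (b → ℝ) → ℝ) :
    affInt A₁ P' Φ =
      (kappaFP L Γ P')⁻¹ * affInt A₁ P (fun A => Real.exp (-(1/2 : ℝ) * ((L *ᵥ A) ⬝ᵥ (L *ᵥ A))) * Φ (T *ᵥ A)) := by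
  rw [fp_affInt_gaussian hLT hTΓ hcompl hQΓ hLΓ hP hP' hA₁ Φ, ← mul_assoc,
    inv_mul_cancel₀ (B9Eq3183.kappaFP_pos hLT hcompl hQΓ hLΓ hP').ne', one_mul]

/-- The normalised means agree literally (`Z⁻¹(B)` = value at a reference integrand): `κ_FP` cancels.
[cite: Balaban1985BackgroundPropagators, (3.121) p.419] -/
theorem fp_affInt_normalised [Fintype b] [Fintype r] [Fintype τ] [Fintype σ] [DecidableEq b] [DecidableEq τ]
    [DecidableEq σ] (hLT : L * T = 0) (hTΓ : T * Γ = 0) (hcompl : 1 - T = Γ * M) (hQΓ : Qt * Γ = 0)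
    (hLΓ : Function.Injective (L * Γ).mulVec) {P : Matrix b (σ ⊕ τ) ℝ} (hP : IsBasisOf P (avgSet Qt))
    {P' : Matrix b σ ℝ} (hP' : IsBasisOf P' (reducedSet Qt L)) {A₁ : b → ℝ} (hA₁ : L *ᵥ A₁ = 0)
    (Φ Φ₀ : (b → ℝ) → ℝ) :
    affInt A₁ P (fun A => Real.exp (-(1/2 : ℝ) * ((L *ᵥ A) ⬝ᵥ (L *ᵥ A))) * Φ (T *ᵥ A)) /
        affInt A₁ P (fun A => Real.exp (-(1/2 : ℝ) * ((L *ᵥ A) ⬝ᵥ (L *ᵥ A))) * Φ₀ (T *ᵥ A)) =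
      affInt A₁ P' Φ / affInt A₁ P' Φ₀ := by
  rw [fp_affInt_gaussian hLT hTΓ hcompl hQΓ hLΓ hP hP' hA₁ Φ, fp_affInt_gaussian hLT hTΓ hcompl hQΓ hLΓ hP hP' hA₁ Φ₀,
    mul_div_mul_left _ _ (B9Eq3183.kappaFP_pos hLT hcompl hQΓ hLΓ hP').ne']

end AffineFP

/-! ## §3  The paper's Sect. D: (3.121), (3.125), (3.140) ⇒ (3.141), (3.145) -/

section Paper

variable {n b m q τ σ : Type*}

variable (D : Matrix b n ℝ) (Δ : Matrix n n ℝ) (Q : Matrix m n ℝ) (a : ℝ) (N : Matrix n τ ℝ) (K : Matrix b b ℝ)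
  (Qb : Matrix q b ℝ) (Dbar : Matrix q m ℝ) (ab : ℝ)

/-- *"It is obtained by gauge transforming an arbitrary configuration A to the subspace {A:RD\*A = 0}"*: `TA₀` lies on
the double fibre `{QA = QA₀, RD*A = 0}` — every fibre `{QA = B}` (`B = QA₀`) has a slice base point ([g15's]
`B9SectDFP.Qb_mulVec_tOp`, `R_Dt_mulVec_tOp`, BY NAME). [cite: Balaban1985BackgroundPropagators, p.419 (text after (3.119))] -/
theorem basePoint_tOp [Fintype n] [Fintype m] [Fintype b] [Fintype q] [DecidableEq n] [DecidableEq m] [DecidableEq b]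
    (hD : Dᵀ * D = Δ) (hΔ' : IsUnit (B9H163.Δ' Δ Q a)) (hM' : IsUnit (B9H163.M' Δ Q a)) (h115 : Qb * D = Dbar * Q)
    (A₀ : b → ℝ) :
    Qb *ᵥ (B9SectDFP.tOp Δ Q a D *ᵥ A₀) = Qb *ᵥ A₀ ∧
      B9H163.R Δ Q a *ᵥ (Dᵀ *ᵥ (B9SectDFP.tOp Δ Q a D *ᵥ A₀)) = 0 :=
  ⟨B9SectDFP.Qb_mulVec_tOp Δ Q a hM' D Qb Dbar h115 A₀, B9SectDFP.R_Dt_mulVec_tOp Δ Q a hΔ' hM' D hD A₀⟩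

/-- The supports of `δ(QA − B)δ_R(RD\*A)` and of `δ(QA − B)` in (3.121) ARE the affine subspaces `A₁ + S`, `A₁ + V`
through any slice point `A₁` of the fibre (`B = QA₁`). [cite: Balaban1985BackgroundPropagators, (3.121) p.419] -/
theorem fibres_3121 [Fintype n] [Fintype m] [Fintype b] [DecidableEq n] [DecidableEq m] [DecidableEq b] {A₁ : b → ℝ} (hA₁ : B9H163.R Δ Q a *ᵥ (Dᵀ *ᵥ A₁) = 0) :
    {A : b → ℝ | Qb *ᵥ A = Qb *ᵥ A₁ ∧ B9H163.R Δ Q a *ᵥ (Dᵀ *ᵥ A) = 0} =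
        (fun v => A₁ + v) '' reducedSet Qb (B9H163.R Δ Q a * Dᵀ) ∧
      {A : b → ℝ | Qb *ᵥ A = Qb *ᵥ A₁} = (fun v => A₁ + v) '' avgSet Qb := by
  refine ⟨?_, fibre_eq_image Qb A₁⟩
  have h := doubleFibre_eq_image Qb (B9H163.R Δ Q a * Dᵀ) (A₁ := A₁) (by rw [← mulVec_mulVec, hA₁])
  simp_rw [← mulVec_mulVec] at h
  exact h

/-- **(3.121) AT MEASURE LEVEL** (hypotheses of §2 discharged by [g18's] `B9Eq3183` §3): for every bond form `K`, every
slice point `A₁` (`RD*A₁ = 0`, fibre `B = QA₁`), every `Φ` and all bases,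
`∫_{QA=B,RD*A=0} e^{−½⟨A,KA⟩}Φ(A) dA = κ_FP⁻¹ ∫_{QA=B} exp[−½⟨A,Δ_πA⟩ − ½‖RD*A‖²] Φ(A − DG′RD*A) dA` — the print's
first member (slice integral of (3.112)) equals its last member; `⟨TA, K·TA⟩ = ⟨A, Δ_πA⟩` is [g15's]
`B9SectDFP.piOp_quadForm`. [cite: Balaban1985BackgroundPropagators, (3.121) p.419] -/
theorem eq_3121 [Fintype n] [Fintype b] [Fintype m] [Fintype q] [Fintype τ] [Fintype σ] [DecidableEq n]
    [DecidableEq b] [DecidableEq m] [DecidableEq τ] [DecidableEq σ] (e : n ≃ τ ⊕ m) (hD : Dᵀ * D = Δ)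
    (hΔ' : IsUnit (B9H163.Δ' Δ Q a)) (hM' : IsUnit (B9H163.M' Δ Q a)) (hQN : Q * N = 0)
    (hQM : IsUnit (Q * Qᵀ).det) (hT : IsUnit (Nᵀ * (Δ * Δ) * N).det) (h115 : Qb * D = Dbar * Q)
    {P : Matrix b (σ ⊕ τ) ℝ} (hP : IsBasisOf P (avgSet Qb)) {P' : Matrix b σ ℝ}
    (hP' : IsBasisOf P' (reducedSet Qb (B9H163.R Δ Q a * Dᵀ))) {A₁ : b → ℝ}
    (hA₁ : B9H163.R Δ Q a *ᵥ (Dᵀ *ᵥ A₁) = 0) (Φ : (b → ℝ) → ℝ) :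
    affInt A₁ P' (fun A => Real.exp (-(1/2 : ℝ) * (A ⬝ᵥ K *ᵥ A)) * Φ A) =
      (kappaFP (B9H163.R Δ Q a * Dᵀ) (D * N) P')⁻¹ *
        affInt A₁ P (fun A => Real.exp (-(1/2 : ℝ) * (A ⬝ᵥ B9SectDFP.piOp K Δ Q a D *ᵥ A) -
          (1/2 : ℝ) * ((B9H163.R Δ Q a *ᵥ (Dᵀ *ᵥ A)) ⬝ᵥ (B9H163.R Δ Q a *ᵥ (Dᵀ *ᵥ A)))) *
          Φ (B9SectDFP.tOp Δ Q a D *ᵥ A)) := by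
  have hA₁' : (B9H163.R Δ Q a * Dᵀ) *ᵥ A₁ = 0 := by rw [← mulVec_mulVec, hA₁]
  have h := fp_affInt_gaussian_inv (B9Eq3183.landau_T D Δ Q a hD hΔ' hM') (B9Eq3183.T_gauge D Δ Q a N hD hΔ' hQN)
    (B9Eq3183.T_compl D Δ Q a N e hD hΔ' hQN hQM hT) (B9Eq3183.avg_gauge D Q N Qb Dbar h115 hQN)
    (B9Eq3183.landau_gauge_injective D Δ Q a N hD hΔ' hQN hT) hP hP' hA₁'
    (fun X => Real.exp (-(1/2 : ℝ) * (X ⬝ᵥ K *ᵥ X)) * Φ X)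
  beta_reduce at h
  rw [h]
  congr 1
  refine congrArg (affInt A₁ P) (funext fun A => ?_)
  rw [← mulVec_mulVec, ← B9SectDFP.piOp_quadForm, ← mul_assoc, ← Real.exp_add]
  congr 2
  ring

/-- **(3.121), normalised**: the `Z⁻¹(B)`-normalised mean of `Φ` over the double fibre equals the normalised mean of
`Φ(A − DG′RD*A)` over `{QA = B}` with the exponential gauge-fixing density — ALL constants cancel.
[cite: Balaban1985BackgroundPropagators, (3.121) p.419] -/
theorem eq_3121_normalised [Fintype n] [Fintype b] [Fintype m] [Fintype q] [Fintype τ] [Fintype σ] [DecidableEq n]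
    [DecidableEq b] [DecidableEq m] [DecidableEq τ] [DecidableEq σ] (e : n ≃ τ ⊕ m) (hD : Dᵀ * D = Δ)
    (hΔ' : IsUnit (B9H163.Δ' Δ Q a)) (hM' : IsUnit (B9H163.M' Δ Q a)) (hQN : Q * N = 0)
    (hQM : IsUnit (Q * Qᵀ).det) (hT : IsUnit (Nᵀ * (Δ * Δ) * N).det) (h115 : Qb * D = Dbar * Q)
    {P : Matrix b (σ ⊕ τ) ℝ} (hP : IsBasisOf P (avgSet Qb)) {P' : Matrix b σ ℝ}
    (hP' : IsBasisOf P' (reducedSet Qb (B9H163.R Δ Q a * Dᵀ))) {A₁ : b → ℝ}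
    (hA₁ : B9H163.R Δ Q a *ᵥ (Dᵀ *ᵥ A₁) = 0) (Φ Φ₀ : (b → ℝ) → ℝ) :
    affInt A₁ P' (fun A => Real.exp (-(1/2 : ℝ) * (A ⬝ᵥ K *ᵥ A)) * Φ A) /
        affInt A₁ P' (fun A => Real.exp (-(1/2 : ℝ) * (A ⬝ᵥ K *ᵥ A)) * Φ₀ A) =
      affInt A₁ P (fun A => Real.exp (-(1/2 : ℝ) * (A ⬝ᵥ B9SectDFP.piOp K Δ Q a D *ᵥ A) -
          (1/2 : ℝ) * ((B9H163.R Δ Q a *ᵥ (Dᵀ *ᵥ A)) ⬝ᵥ (B9H163.R Δ Q a *ᵥ (Dᵀ *ᵥ A)))) *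
          Φ (B9SectDFP.tOp Δ Q a D *ᵥ A)) /
        affInt A₁ P (fun A => Real.exp (-(1/2 : ℝ) * (A ⬝ᵥ B9SectDFP.piOp K Δ Q a D *ᵥ A) -
          (1/2 : ℝ) * ((B9H163.R Δ Q a *ᵥ (Dᵀ *ᵥ A)) ⬝ᵥ (B9H163.R Δ Q a *ᵥ (Dᵀ *ᵥ A)))) *
          Φ₀ (B9SectDFP.tOp Δ Q a D *ᵥ A)) := by
  have hκ := B9Eq3183.kappaFP_pos (B9Eq3183.landau_T D Δ Q a hD hΔ' hM')
    (B9Eq3183.T_compl D Δ Q a N e hD hΔ' hQN hQM hT) (B9Eq3183.avg_gauge D Q N Qb Dbar h115 hQN)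
    (B9Eq3183.landau_gauge_injective D Δ Q a N hD hΔ' hQN hT) hP'
  rw [eq_3121 D Δ Q a N K Qb Dbar e hD hΔ' hM' hQN hQM hT h115 hP hP' hA₁ Φ,
    eq_3121 D Δ Q a N K Qb Dbar e hD hΔ' hM' hQN hQM hT h115 hP hP' hA₁ Φ₀,
    mul_div_mul_left _ _ (inv_ne_zero hκ.ne')]

/-- `DRD* = (RD*)ᵀ(RD*)` (`Rᵀ = R`, `R² = R`: [g13's] `B9SectECov.R_transpose`, `R_mul_R`). [folklore] -/
theorem DRDt_eq [Fintype n] [Fintype m] [Fintype b] [DecidableEq n] [DecidableEq m] (hΔ : Δ.IsSymm)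
    (hM' : IsUnit (B9H163.M' Δ Q a)) :
    D * B9H163.R Δ Q a * Dᵀ = (B9H163.R Δ Q a * Dᵀ)ᵀ * (B9H163.R Δ Q a * Dᵀ) := by
  have hRt := B9SectECov.R_transpose Δ Q a hΔ
  have hRR := B9SectECov.R_mul_R Δ Q a hM'
  rw [transpose_mul, transpose_transpose, hRt]
  simp only [Matrix.mul_assoc]
  rw [← Matrix.mul_assoc (B9H163.R Δ Q a) (B9H163.R Δ Q a), hRR]

/-- `⟨A, DRD*A⟩ = ‖RD*A‖²`. [cite: Balaban1985BackgroundPropagators, (3.121) p.419] -/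
theorem RDt_normSq [Fintype n] [Fintype m] [Fintype b] [DecidableEq n] [DecidableEq m] (hΔ : Δ.IsSymm)
    (hM' : IsUnit (B9H163.M' Δ Q a)) (A : b → ℝ) :
    A ⬝ᵥ (D * B9H163.R Δ Q a * Dᵀ) *ᵥ A = (B9H163.R Δ Q a *ᵥ (Dᵀ *ᵥ A)) ⬝ᵥ (B9H163.R Δ Q a *ᵥ (Dᵀ *ᵥ A)) := by
  rw [DRDt_eq D Δ Q a hΔ hM', Beta.GaussianIntegral.dotProduct_transpose_mul_self_mulVec, ← mulVec_mulVec]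

/-- **(3.121) with the exponent AS PRINTED in its last member**, `exp[−½⟨A, Δ_πA⟩ − ½⟨A, DRD\*A⟩]`
(`⟨A, DRD*A⟩ = ‖RD*A‖²`: `RDt_normSq`). [cite: Balaban1985BackgroundPropagators, (3.121) p.419] -/
theorem eq_3121_print [Fintype n] [Fintype b] [Fintype m] [Fintype q] [Fintype τ] [Fintype σ] [DecidableEq n]
    [DecidableEq b] [DecidableEq m] [DecidableEq τ] [DecidableEq σ] (e : n ≃ τ ⊕ m) (hD : Dᵀ * D = Δ)
    (hΔ' : IsUnit (B9H163.Δ' Δ Q a)) (hM' : IsUnit (B9H163.M' Δ Q a)) (hQN : Q * N = 0)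
    (hQM : IsUnit (Q * Qᵀ).det) (hT : IsUnit (Nᵀ * (Δ * Δ) * N).det) (h115 : Qb * D = Dbar * Q)
    {P : Matrix b (σ ⊕ τ) ℝ} (hP : IsBasisOf P (avgSet Qb)) {P' : Matrix b σ ℝ}
    (hP' : IsBasisOf P' (reducedSet Qb (B9H163.R Δ Q a * Dᵀ))) {A₁ : b → ℝ}
    (hA₁ : B9H163.R Δ Q a *ᵥ (Dᵀ *ᵥ A₁) = 0) (Φ : (b → ℝ) → ℝ) :
    affInt A₁ P' (fun A => Real.exp (-(1/2 : ℝ) * (A ⬝ᵥ K *ᵥ A)) * Φ A) =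
      (kappaFP (B9H163.R Δ Q a * Dᵀ) (D * N) P')⁻¹ *
        affInt A₁ P (fun A => Real.exp (-(1/2 : ℝ) * (A ⬝ᵥ B9SectDFP.piOp K Δ Q a D *ᵥ A) -
          (1/2 : ℝ) * (A ⬝ᵥ (D * B9H163.R Δ Q a * Dᵀ) *ᵥ A)) * Φ (B9SectDFP.tOp Δ Q a D *ᵥ A)) := by
  rw [eq_3121 D Δ Q a N K Qb Dbar e hD hΔ' hM' hQN hQM hT h115 hP hP' hA₁ Φ]
  simp_rw [RDt_normSq D Δ Q a (B9Eq3183.isSymm_of_DtD D Δ hD) hM']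

/-- **(3.121) ⇒ (3.123), the weight**: on the fibre `QA = B` the density of the last member of (3.121) IS
`e^{½a‖B‖²} · e^{−½⟨A,G⁻¹A⟩}` ([g15's] `B9SectDFP.eq_3123_weight` = (3.122), BY NAME).
[cite: Balaban1985BackgroundPropagators, (3.122)-(3.123) p.420] -/
theorem fpWeight_eq_Ginv [Fintype n] [Fintype m] [Fintype b] [Fintype q] [DecidableEq n] [DecidableEq m] [DecidableEq b]
    (hΔ : Δ.IsSymm) (hM' : IsUnit (B9H163.M' Δ Q a)) (A : b → ℝ) (B : q → ℝ) (hB : Qb *ᵥ A = B) :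
    Real.exp (-(1/2 : ℝ) * (A ⬝ᵥ B9SectDFP.piOp K Δ Q a D *ᵥ A) -
        (1/2 : ℝ) * ((B9H163.R Δ Q a *ᵥ (Dᵀ *ᵥ A)) ⬝ᵥ (B9H163.R Δ Q a *ᵥ (Dᵀ *ᵥ A)))) =
      Real.exp ((1/2 : ℝ) * (ab * (B ⬝ᵥ B))) *
        Real.exp (-(1/2 : ℝ) * (A ⬝ᵥ B9SectDFP.Ginv K Δ Q a D Qb ab *ᵥ A)) := by
  rw [← RDt_normSq D Δ Q a hΔ hM' A]
  exact B9SectDFP.eq_3123_weight K Δ Q a D Qb ab A B hB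

/-- **(3.121) in the form that is translated in (3.123)**: the normalised (3.121)/(3.112) mean of `Φ` over
`{QA = B, RD*A = 0}` equals the normalised `G⁻¹`-GAUSSIAN mean of `Φ(A − DG′RD*A)` over the fibre `{QA = B}`
(the factor `e^{½a‖B‖²}` is constant on the fibre and cancels) — *"Making in the last integral in (3.121) a translation to
this minimum we get"* (3.123). [cite: Balaban1985BackgroundPropagators, (3.121) p.419; (3.123) p.420] -/
theorem eq_3121_3123 [Fintype n] [Fintype b] [Fintype m] [Fintype q] [Fintype τ] [Fintype σ] [DecidableEq n]
    [DecidableEq b] [DecidableEq m] [DecidableEq τ] [DecidableEq σ] (e : n ≃ τ ⊕ m) (hD : Dᵀ * D = Δ)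
    (hΔ' : IsUnit (B9H163.Δ' Δ Q a)) (hM' : IsUnit (B9H163.M' Δ Q a)) (hQN : Q * N = 0)
    (hQM : IsUnit (Q * Qᵀ).det) (hT : IsUnit (Nᵀ * (Δ * Δ) * N).det) (h115 : Qb * D = Dbar * Q)
    {P : Matrix b (σ ⊕ τ) ℝ} (hP : IsBasisOf P (avgSet Qb)) {P' : Matrix b σ ℝ}
    (hP' : IsBasisOf P' (reducedSet Qb (B9H163.R Δ Q a * Dᵀ))) {A₁ : b → ℝ}
    (hA₁ : B9H163.R Δ Q a *ᵥ (Dᵀ *ᵥ A₁) = 0) (B : q → ℝ) (hB : Qb *ᵥ A₁ = B) (Φ Φ₀ : (b → ℝ) → ℝ) :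
    affInt A₁ P' (fun A => Real.exp (-(1/2 : ℝ) * (A ⬝ᵥ K *ᵥ A)) * Φ A) /
        affInt A₁ P' (fun A => Real.exp (-(1/2 : ℝ) * (A ⬝ᵥ K *ᵥ A)) * Φ₀ A) =
      affInt A₁ P (fun A => Real.exp (-(1/2 : ℝ) * (A ⬝ᵥ B9SectDFP.Ginv K Δ Q a D Qb ab *ᵥ A)) *
          Φ (B9SectDFP.tOp Δ Q a D *ᵥ A)) /
        affInt A₁ P (fun A => Real.exp (-(1/2 : ℝ) * (A ⬝ᵥ B9SectDFP.Ginv K Δ Q a D Qb ab *ᵥ A)) *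
          Φ₀ (B9SectDFP.tOp Δ Q a D *ᵥ A)) := by
  have hΔ : Δ.IsSymm := B9Eq3183.isSymm_of_DtD D Δ hD
  have hc : ∀ Ψ : (b → ℝ) → ℝ,
      affInt A₁ P (fun A => Real.exp (-(1/2 : ℝ) * (A ⬝ᵥ B9SectDFP.piOp K Δ Q a D *ᵥ A) -
          (1/2 : ℝ) * ((B9H163.R Δ Q a *ᵥ (Dᵀ *ᵥ A)) ⬝ᵥ (B9H163.R Δ Q a *ᵥ (Dᵀ *ᵥ A)))) *
          Ψ (B9SectDFP.tOp Δ Q a D *ᵥ A)) =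
        Real.exp ((1/2 : ℝ) * (ab * (B ⬝ᵥ B))) *
          affInt A₁ P (fun A => Real.exp (-(1/2 : ℝ) * (A ⬝ᵥ B9SectDFP.Ginv K Δ Q a D Qb ab *ᵥ A)) *
            Ψ (B9SectDFP.tOp Δ Q a D *ᵥ A)) := by
    intro Ψ
    rw [← affInt_const_mul]
    refine affInt_congr hP (fun v hv => ?_)
    have hv' : Qb *ᵥ v = 0 := hv
    have hBv : Qb *ᵥ (A₁ + v) = B := by rw [mulVec_add, hv', add_zero, hB]
    rw [fpWeight_eq_Ginv D Δ Q a K Qb ab hΔ hM' (A₁ + v) B hBv, mul_assoc]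
  rw [eq_3121_normalised D Δ Q a N K Qb Dbar e hD hΔ' hM' hQN hQM hT h115 hP hP' hA₁ Φ Φ₀, hc Φ, hc Φ₀,
    mul_div_mul_left _ _ (Real.exp_pos _).ne']

/-- **The (3.112) integral is over a basis of the slice**: a kernel basis `N_S` of [g15's] double constraint
`S = [Q_b ; NᵀΔD*]` (`SN_S = 0`, `N_SᵀN_S` nonsingular) IS a basis of `{QA = 0, RD*A = 0}` — so the first member of (3.121)
is, up to `√det(N_SᵀN_S)`, the coordinate integral `∫dz … (A₀ + N_Sz)` of `B9Eq3112.eq_3112`.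
[cite: Balaban1985BackgroundPropagators, (3.110)-(3.112) pp.417-418] -/
theorem isBasisOf_dconKernel [Fintype n] [Fintype b] [Fintype m] [Fintype q] [Fintype τ] [Fintype σ] [DecidableEq n]
    [DecidableEq b] [DecidableEq m] [DecidableEq q] [DecidableEq τ] [DecidableEq σ] (eS : b ≃ σ ⊕ (q ⊕ τ))
    (e : n ≃ τ ⊕ m) (hD : Dᵀ * D = Δ) (hΔ' : IsUnit (B9H163.Δ' Δ Q a)) (hQN : Q * N = 0)
    (hQM : IsUnit (Q * Qᵀ).det) (hT : IsUnit (Nᵀ * (Δ * Δ) * N).det) (h115 : Qb * D = Dbar * Q)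
    (hQbM : IsUnit (Qb * Qbᵀ).det) {NS : Matrix b σ ℝ} (hSN : B9Eq3112.dcon Δ N D Qb * NS = 0)
    (hNSA : IsUnit (NSᵀ * NS).det) : IsBasisOf NS (reducedSet Qb (B9H163.R Δ Q a * Dᵀ)) := by
  have hΔ : Δ.IsSymm := B9Eq3183.isSymm_of_DtD D Δ hD
  have hSM := B9Eq3112.dcon_gram Δ Q N hQN hT D hD Qb Dbar h115 hQbM
  refine ⟨?_, Set.ext fun A => ⟨?_, ?_⟩⟩
  · intro v w h
    rw [← sub_eq_zero] at h ⊢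
    rw [← mulVec_sub] at h
    exact B9SectECov.eq_zero_of_kernelBasis hNSA h
  · rintro ⟨z, rfl⟩
    have hk := B9Eq3112.dcon_kernel Δ N D Qb NS hSN z
    show Reduced Qb (B9H163.R Δ Q a * Dᵀ) (NS *ᵥ z)
    refine ⟨hk.1, ?_⟩
    rw [← mulVec_mulVec]
    exact (B9Eq3112.R_Dt_mulVec_eq_zero_iff e Δ Q a hΔ hΔ' N hQN hQM hT D (NS *ᵥ z)).mpr hk.2
  · intro hA
    have hA' : Reduced Qb (B9H163.R Δ Q a * Dᵀ) A := hA
    have hker : B9Eq3112.dcon Δ N D Qb *ᵥ A = 0 :=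
      ((B9Eq3112.dcon_mulVec_eq_iff e Δ Q a hΔ hΔ' N hQN hQM hT D Qb A 0).mpr
        ⟨hA'.avg, by rw [mulVec_mulVec]; exact hA'.landau⟩).trans B9Eq3112.sumElim_zero_zero
    exact ⟨_, (B9Eq3166.kernel_eq_mulVec eS (B9Eq3112.dcon Δ N D Qb) NS hSN hNSA hSM hker).symm⟩

/-- **(3.125)**: `∫ dA e^{−½⟨A,G⁻¹A⟩} (RD*A)_i (QA)_j = 0` over the whole configuration space, for all `i, j` — the
integral the identities (3.124) `RD*GQ* = 0` rest on; exactly as printed: split off `e^{−½‖RD*A‖²}`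
(`B9SectDFP.Ginv_quadForm`, `Q(TA) = QA`), Faddeev–Popov with `V` = everything, odd `λ`-integral.
(`P`, `P′`: any bases of `ℝ^b` and of `{RD*A = 0}` — auxiliary.) [cite: Balaban1985BackgroundPropagators, (3.125) p.420] -/
theorem eq_3125 [Fintype n] [Fintype b] [Fintype m] [Fintype q] [Fintype τ] [Fintype σ] [DecidableEq n]
    [DecidableEq b] [DecidableEq m] [DecidableEq τ] [DecidableEq σ] (e : n ≃ τ ⊕ m) (hD : Dᵀ * D = Δ)
    (hΔ' : IsUnit (B9H163.Δ' Δ Q a)) (hM' : IsUnit (B9H163.M' Δ Q a)) (hQN : Q * N = 0)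
    (hQM : IsUnit (Q * Qᵀ).det) (hT : IsUnit (Nᵀ * (Δ * Δ) * N).det) (h115 : Qb * D = Dbar * Q)
    {P : Matrix b (σ ⊕ τ) ℝ} (hP : IsBasisOf P Set.univ) {P' : Matrix b σ ℝ}
    (hP' : IsBasisOf P' {A | B9H163.R Δ Q a *ᵥ (Dᵀ *ᵥ A) = 0}) (i : n) (j : q) :
    ∫ A : b → ℝ, Real.exp (-(1/2 : ℝ) * (A ⬝ᵥ B9SectDFP.Ginv K Δ Q a D Qb ab *ᵥ A)) *
        (B9H163.R Δ Q a *ᵥ (Dᵀ *ᵥ A)) i * (Qb *ᵥ A) j = 0 := by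
  have hΔ : Δ.IsSymm := B9Eq3183.isSymm_of_DtD D Δ hD
  have hP₀ : IsBasisOf P (avgSet (0 : Matrix q b ℝ)) := by rwa [avgSet_zero]
  have hP'₀ : IsBasisOf P' (reducedSet (0 : Matrix q b ℝ) (B9H163.R Δ Q a * Dᵀ)) := by
    rw [reducedSet_zero]; simpa only [mulVec_mulVec] using hP'
  have h := fp_affInt_firstMoment (B9Eq3183.landau_T D Δ Q a hD hΔ' hM') (B9Eq3183.T_gauge D Δ Q a N hD hΔ' hQN)
    (B9Eq3183.T_compl D Δ Q a N e hD hΔ' hQN hQM hT) (Matrix.zero_mul (D * N))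
    (B9Eq3183.landau_gauge_injective D Δ Q a N hD hΔ' hQN hT) hP₀ hP'₀ (mulVec_zero _) i
    (fun X => Real.exp (-(1/2 : ℝ) * (X ⬝ᵥ (K + ab • (Qbᵀ * Qb)) *ᵥ X)) * (Qb *ᵥ X) j)
  beta_reduce at h
  have key : affInt 0 P (fun A => Real.exp (-(1/2 : ℝ) * (A ⬝ᵥ B9SectDFP.Ginv K Δ Q a D Qb ab *ᵥ A)) *
      (B9H163.R Δ Q a *ᵥ (Dᵀ *ᵥ A)) i * (Qb *ᵥ A) j) = 0 := by
    refine Eq.trans (congrArg (affInt 0 P) (funext fun A => ?_)) h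
    rw [B9SectDFP.Ginv_quadForm K Δ Q a hΔ hM' D Qb Dbar h115 ab A,
      B9SectDFP.Qb_mulVec_tOp Δ Q a hM' D Qb Dbar h115 A, ← mulVec_mulVec, mul_add, Real.exp_add]
    ring
  rwa [affInt_univ hP] at key

/-- `T² = T` (`RD*·T = 0`: [g15's] `B9SectDFP.R_mul_Dt_mul_tOp`). [cite: Balaban1985BackgroundPropagators, (3.121) p.419] -/
theorem tOp_mul_tOp [Fintype n] [Fintype m] [Fintype b] [DecidableEq n] [DecidableEq m] [DecidableEq b]
    (hD : Dᵀ * D = Δ) (hΔ' : IsUnit (B9H163.Δ' Δ Q a)) (hM' : IsUnit (B9H163.M' Δ Q a)) :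
    B9SectDFP.tOp Δ Q a D * B9SectDFP.tOp Δ Q a D = B9SectDFP.tOp Δ Q a D := by
  have h := B9SectDFP.R_mul_Dt_mul_tOp Δ Q a hΔ' hM' D hD
  have h0 : D * B9H163.G' Δ Q a * B9H163.R Δ Q a * Dᵀ * B9SectDFP.tOp Δ Q a D = 0 := by
    rw [Matrix.mul_assoc (D * B9H163.G' Δ Q a), Matrix.mul_assoc (D * B9H163.G' Δ Q a), h, Matrix.mul_zero]
  calc B9SectDFP.tOp Δ Q a D * B9SectDFP.tOp Δ Q a D
      = (1 - D * B9H163.G' Δ Q a * B9H163.R Δ Q a * Dᵀ) * B9SectDFP.tOp Δ Q a D := rfl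
    _ = B9SectDFP.tOp Δ Q a D := by rw [sub_mul, one_mul, h0, sub_zero]

/-- `TᵀΔ_π = Δ_π` (`Δ_π = TᵀKT`, `T² = T`). [cite: Balaban1985BackgroundPropagators, (3.119) p.419; (3.141) p.424] -/
theorem transpose_tOp_mul_piOp [Fintype n] [Fintype m] [Fintype b] [DecidableEq n] [DecidableEq m] [DecidableEq b]
    (hD : Dᵀ * D = Δ) (hΔ' : IsUnit (B9H163.Δ' Δ Q a)) (hM' : IsUnit (B9H163.M' Δ Q a)) :
    (B9SectDFP.tOp Δ Q a D)ᵀ * B9SectDFP.piOp K Δ Q a D = B9SectDFP.piOp K Δ Q a D := by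
  have hTT := tOp_mul_tOp D Δ Q a hD hΔ' hM'
  rw [B9SectDFP.piOp, ← Matrix.mul_assoc, ← Matrix.mul_assoc, ← transpose_mul, hTT]

/-- `Δ_πT = Δ_π`. [cite: Balaban1985BackgroundPropagators, (3.119) p.419] -/
theorem piOp_mul_tOp [Fintype n] [Fintype m] [Fintype b] [DecidableEq n] [DecidableEq m] [DecidableEq b]
    (hD : Dᵀ * D = Δ) (hΔ' : IsUnit (B9H163.Δ' Δ Q a)) (hM' : IsUnit (B9H163.M' Δ Q a)) :
    B9SectDFP.piOp K Δ Q a D * B9SectDFP.tOp Δ Q a D = B9SectDFP.piOp K Δ Q a D := by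
  rw [B9SectDFP.piOp, Matrix.mul_assoc, tOp_mul_tOp D Δ Q a hD hΔ' hM']

/-- **The exponent of (3.141)**: on `{QA = 0}`, with `G₁⁻¹ = Δ_π + Δ_π^{(2)} + DRD* + a_bQ*Q` symmetric,
`−½‖RD*A‖² − ½⟨TA − A₀, G₁⁻¹(TA − A₀)⟩ = −½⟨A₀,G₁⁻¹A₀⟩ − ½⟨A,G₁⁻¹A⟩ + ⟨A,(Δ_π+Δ_π^{(2)})A₀⟩` (`T² = T`, `RD*T = 0`,
`Q(TA) = QA = 0`, `TᵀΔ_π = Δ_π`). [cite: Balaban1985BackgroundPropagators, (3.140)-(3.141) p.424] -/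
theorem eq_3141_exponent [Fintype n] [Fintype m] [Fintype b] [Fintype q] [DecidableEq n] [DecidableEq m]
    [DecidableEq b] (hK : Kᵀ = K) (hD : Dᵀ * D = Δ) (hΔ' : IsUnit (B9H163.Δ' Δ Q a))
    (hM' : IsUnit (B9H163.M' Δ Q a)) (h115 : Qb * D = Dbar * Q) (A A₀ : b → ℝ) (hA : Qb *ᵥ A = 0) :
    -(1/2 : ℝ) * ((B9H163.R Δ Q a *ᵥ (Dᵀ *ᵥ A)) ⬝ᵥ (B9H163.R Δ Q a *ᵥ (Dᵀ *ᵥ A))) +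
        -(1/2 : ℝ) * ((B9SectDFP.tOp Δ Q a D *ᵥ A - A₀) ⬝ᵥ
          B9SectDFP.Ginv K Δ Q a D Qb ab *ᵥ (B9SectDFP.tOp Δ Q a D *ᵥ A - A₀)) =
      -(1/2 : ℝ) * (A₀ ⬝ᵥ B9SectDFP.Ginv K Δ Q a D Qb ab *ᵥ A₀) +
        (-(1/2 : ℝ) * (A ⬝ᵥ B9SectDFP.Ginv K Δ Q a D Qb ab *ᵥ A) + A ⬝ᵥ B9SectDFP.piOp K Δ Q a D *ᵥ A₀) := by
  have hΔ : Δ.IsSymm := B9Eq3183.isSymm_of_DtD D Δ hD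
  have hTT : B9SectDFP.tOp Δ Q a D *ᵥ (B9SectDFP.tOp Δ Q a D *ᵥ A) = B9SectDFP.tOp Δ Q a D *ᵥ A := by
    rw [mulVec_mulVec, tOp_mul_tOp D Δ Q a hD hΔ' hM']
  have hRT : B9H163.R Δ Q a *ᵥ (Dᵀ *ᵥ (B9SectDFP.tOp Δ Q a D *ᵥ A)) = 0 :=
    B9SectDFP.R_Dt_mulVec_tOp Δ Q a hΔ' hM' D hD A
  -- F1: ⟨TA, G₁⁻¹TA⟩ = ⟨A, G₁⁻¹A⟩ − ‖RD*A‖²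
  have q1 := B9SectDFP.Ginv_quadForm K Δ Q a hΔ hM' D Qb Dbar h115 ab (B9SectDFP.tOp Δ Q a D *ᵥ A)
  rw [hTT, hRT, zero_dotProduct, add_zero] at q1
  have q2 := B9SectDFP.Ginv_quadForm K Δ Q a hΔ hM' D Qb Dbar h115 ab A
  have F1 : (B9SectDFP.tOp Δ Q a D *ᵥ A) ⬝ᵥ B9SectDFP.Ginv K Δ Q a D Qb ab *ᵥ (B9SectDFP.tOp Δ Q a D *ᵥ A) =
      A ⬝ᵥ B9SectDFP.Ginv K Δ Q a D Qb ab *ᵥ A -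
        (B9H163.R Δ Q a *ᵥ (Dᵀ *ᵥ A)) ⬝ᵥ (B9H163.R Δ Q a *ᵥ (Dᵀ *ᵥ A)) := by
    rw [q1, q2]; ring
  -- F2: ⟨TA, G₁⁻¹A₀⟩ = ⟨A, Δ_πA₀⟩
  have F2a : (B9SectDFP.tOp Δ Q a D *ᵥ A) ⬝ᵥ (B9SectDFP.piOp K Δ Q a D *ᵥ A₀) =
      A ⬝ᵥ (B9SectDFP.piOp K Δ Q a D *ᵥ A₀) := by
    rw [dotProduct_mulVec_left (B9SectDFP.tOp Δ Q a D) A, mulVec_mulVec, transpose_tOp_mul_piOp D Δ Q a K hD hΔ' hM']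
  have F2b : (B9SectDFP.tOp Δ Q a D *ᵥ A) ⬝ᵥ ((D * B9H163.R Δ Q a * Dᵀ) *ᵥ A₀) = 0 := by
    rw [DRDt_eq D Δ Q a hΔ hM', ← mulVec_mulVec,
      ← dotProduct_mulVec_left (B9H163.R Δ Q a * Dᵀ) (B9SectDFP.tOp Δ Q a D *ᵥ A), mulVec_mulVec,
      B9Eq3183.landau_T D Δ Q a hD hΔ' hM', zero_mulVec, zero_dotProduct]
  have F2c : (B9SectDFP.tOp Δ Q a D *ᵥ A) ⬝ᵥ ((ab • (Qbᵀ * Qb)) *ᵥ A₀) = 0 := by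
    rw [smul_mulVec, dotProduct_smul, ← mulVec_mulVec,
      ← dotProduct_mulVec_left Qb (B9SectDFP.tOp Δ Q a D *ᵥ A), B9SectDFP.Qb_mulVec_tOp Δ Q a hM' D Qb Dbar h115 A,
      hA, zero_dotProduct, smul_zero]
  have F2 : (B9SectDFP.tOp Δ Q a D *ᵥ A) ⬝ᵥ (B9SectDFP.Ginv K Δ Q a D Qb ab *ᵥ A₀) =
      A ⬝ᵥ (B9SectDFP.piOp K Δ Q a D *ᵥ A₀) := by
    rw [B9SectDFP.Ginv, add_mulVec, add_mulVec, dotProduct_add, dotProduct_add, F2a, F2b, F2c, add_zero, add_zero]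
  -- F3: symmetry of G₁⁻¹
  have F3 : A₀ ⬝ᵥ (B9SectDFP.Ginv K Δ Q a D Qb ab *ᵥ (B9SectDFP.tOp Δ Q a D *ᵥ A)) =
      (B9SectDFP.tOp Δ Q a D *ᵥ A) ⬝ᵥ (B9SectDFP.Ginv K Δ Q a D Qb ab *ᵥ A₀) := by
    rw [dotProduct_comm A₀, dotProduct_mulVec_left (B9SectDFP.Ginv K Δ Q a D Qb ab) (B9SectDFP.tOp Δ Q a D *ᵥ A) A₀,
      B9SectDFP.Ginv_transpose K hK Δ Q a hΔ D Qb ab]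
  rw [mulVec_sub, sub_dotProduct, dotProduct_sub, dotProduct_sub, F3, F2, F1]
  ring

/-- **(3.140) ⇒ (3.141) AT MEASURE LEVEL** — *"applying the same transformations as in (3.121)"*: for symmetric `K`, every
centre `A₀`, every `Φ` and all bases `P′` of `{QA = 0, RD*A = 0}`, `P` of `{QA = 0}`,
`∫_{QA=0,RD*A=0} e^{−½⟨A−A₀,G₁⁻¹(A−A₀)⟩}Φ(A) dA
 = κ_FP⁻¹ e^{−½⟨A₀,G₁⁻¹A₀⟩} ∫_{QA=0} exp[−½⟨A,G₁⁻¹A⟩ + ⟨A,(Δ_π+Δ_π^{(2)})A₀⟩] Φ(A − DG′RD*A) dA`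
(`G₁⁻¹ = B9SectDFP.Ginv K …`, `Δ_π + Δ_π^{(2)} = B9SectDFP.piOp K …` as in [g17's] `B9Eq3147`; the print's `Φ(A) = A`).
[cite: Balaban1985BackgroundPropagators, (3.140)-(3.141) p.424] -/
theorem eq_3141 [Fintype n] [Fintype b] [Fintype m] [Fintype q] [Fintype τ] [Fintype σ] [DecidableEq n]
    [DecidableEq b] [DecidableEq m] [DecidableEq τ] [DecidableEq σ] (e : n ≃ τ ⊕ m) (hK : Kᵀ = K)
    (hD : Dᵀ * D = Δ) (hΔ' : IsUnit (B9H163.Δ' Δ Q a)) (hM' : IsUnit (B9H163.M' Δ Q a)) (hQN : Q * N = 0)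
    (hQM : IsUnit (Q * Qᵀ).det) (hT : IsUnit (Nᵀ * (Δ * Δ) * N).det) (h115 : Qb * D = Dbar * Q)
    {P : Matrix b (σ ⊕ τ) ℝ} (hP : IsBasisOf P (avgSet Qb)) {P' : Matrix b σ ℝ}
    (hP' : IsBasisOf P' (reducedSet Qb (B9H163.R Δ Q a * Dᵀ))) (A₀ : b → ℝ) (Φ : (b → ℝ) → ℝ) :
    subInt P' (fun A => Real.exp (-(1/2 : ℝ) * ((A - A₀) ⬝ᵥ B9SectDFP.Ginv K Δ Q a D Qb ab *ᵥ (A - A₀))) * Φ A) =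
      (kappaFP (B9H163.R Δ Q a * Dᵀ) (D * N) P')⁻¹ *
        Real.exp (-(1/2 : ℝ) * (A₀ ⬝ᵥ B9SectDFP.Ginv K Δ Q a D Qb ab *ᵥ A₀)) *
        subInt P (fun A => Real.exp (-(1/2 : ℝ) * (A ⬝ᵥ B9SectDFP.Ginv K Δ Q a D Qb ab *ᵥ A) +
            A ⬝ᵥ B9SectDFP.piOp K Δ Q a D *ᵥ A₀) * Φ (B9SectDFP.tOp Δ Q a D *ᵥ A)) := by
  have h := fp_affInt_gaussian_inv (B9Eq3183.landau_T D Δ Q a hD hΔ' hM') (B9Eq3183.T_gauge D Δ Q a N hD hΔ' hQN)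
    (B9Eq3183.T_compl D Δ Q a N e hD hΔ' hQN hQM hT) (B9Eq3183.avg_gauge D Q N Qb Dbar h115 hQN)
    (B9Eq3183.landau_gauge_injective D Δ Q a N hD hΔ' hQN hT) hP hP' (mulVec_zero _)
    (fun X => Real.exp (-(1/2 : ℝ) * ((X - A₀) ⬝ᵥ B9SectDFP.Ginv K Δ Q a D Qb ab *ᵥ (X - A₀))) * Φ X)
  beta_reduce at h
  rw [affInt_zero, affInt_zero] at h
  rw [h, mul_assoc]
  congr 1
  rw [← B9Eq3166.subInt_const_mul]
  refine subInt_congr_mem hP (fun A hA => ?_)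
  have hA' : Qb *ᵥ A = 0 := hA
  rw [← mulVec_mulVec, ← mul_assoc, ← mul_assoc, ← Real.exp_add, ← Real.exp_add,
    eq_3141_exponent D Δ Q a K Qb Dbar ab hK hD hΔ' hM' h115 A A₀ hA']

/-- **(3.145)**: `∫_{QA=0} e^{−½⟨A,G₁⁻¹A⟩}(RD*A)_i((Δ_π + Δ_π^{(2)})A)_j dA = 0` for all `i, j` — *"by the same argument as
in (3.125)"*: split off `e^{−½‖RD*A‖²}` (`Ginv_quadForm`), `(Δ_π+Δ_π^{(2)})A = TᵀK(TA)`, Faddeev–Popov on `V = {QA = 0}`,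
odd `λ`-integral. (`P′`: any basis of `{QA = 0, RD*A = 0}` — auxiliary.)
[cite: Balaban1985BackgroundPropagators, (3.145) p.424] -/
theorem eq_3145 [Fintype n] [Fintype b] [Fintype m] [Fintype q] [Fintype τ] [Fintype σ] [DecidableEq n]
    [DecidableEq b] [DecidableEq m] [DecidableEq τ] [DecidableEq σ] (e : n ≃ τ ⊕ m) (hD : Dᵀ * D = Δ)
    (hΔ' : IsUnit (B9H163.Δ' Δ Q a)) (hM' : IsUnit (B9H163.M' Δ Q a)) (hQN : Q * N = 0)
    (hQM : IsUnit (Q * Qᵀ).det) (hT : IsUnit (Nᵀ * (Δ * Δ) * N).det) (h115 : Qb * D = Dbar * Q)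
    {P : Matrix b (σ ⊕ τ) ℝ} (hP : IsBasisOf P (avgSet Qb)) {P' : Matrix b σ ℝ}
    (hP' : IsBasisOf P' (reducedSet Qb (B9H163.R Δ Q a * Dᵀ))) (i : n) (j : b) :
    subInt P (fun A => Real.exp (-(1/2 : ℝ) * (A ⬝ᵥ B9SectDFP.Ginv K Δ Q a D Qb ab *ᵥ A)) *
        (B9H163.R Δ Q a *ᵥ (Dᵀ *ᵥ A)) i * (B9SectDFP.piOp K Δ Q a D *ᵥ A) j) = 0 := by
  have hΔ : Δ.IsSymm := B9Eq3183.isSymm_of_DtD D Δ hD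
  have h := fp_affInt_firstMoment (B9Eq3183.landau_T D Δ Q a hD hΔ' hM') (B9Eq3183.T_gauge D Δ Q a N hD hΔ' hQN)
    (B9Eq3183.T_compl D Δ Q a N e hD hΔ' hQN hQM hT) (B9Eq3183.avg_gauge D Q N Qb Dbar h115 hQN)
    (B9Eq3183.landau_gauge_injective D Δ Q a N hD hΔ' hQN hT) hP hP' (mulVec_zero _) i
    (fun X => Real.exp (-(1/2 : ℝ) * (X ⬝ᵥ (K + ab • (Qbᵀ * Qb)) *ᵥ X)) *
      (((B9SectDFP.tOp Δ Q a D)ᵀ * K) *ᵥ X) j)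
  beta_reduce at h
  rw [affInt_zero] at h
  refine Eq.trans (congrArg (subInt P) (funext fun A => ?_)) h
  rw [B9SectDFP.Ginv_quadForm K Δ Q a hΔ hM' D Qb Dbar h115 ab A, B9SectDFP.piOp]
  simp only [← mulVec_mulVec]
  rw [mul_add, Real.exp_add]
  ring

end Paper

end

end Literature.MathematicalPhysics.QuantumFieldTheory.Balaban1983to89.B9Eq3121Measure
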